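import Summits.ResolutionOfSingularities.ResolutionOfSingularities.Theorems.PurelyInseparableDim4PureLeafGlobalWin16
import Summits.ResolutionOfSingularities.ResolutionOfSingularities.Theorems.PurelyInseparableDim4Equivariance
import HarnessLib
import HarnessLib.Audit.Tags

/-!
# Purely inseparable fourfolds — PURE LEAVES WIN THE GLOBAL GAME: the typed QUESTION, the kernel BOX
# (exponents ≤ 4, over `𝔽₂`), and `S₄`-symmetry of the plain-game attractor (cell res-dim4-pi, WORD #60)
# [OURS · counted 0 · statements about OUR coordinate-centre frame v4, not about resolution]

Width seat `res-dim4-p-10` (g2).  Summary file of the batch `…PureLeafGlobalWin1–16` (687 landed books-free win rows,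
`WinCertF.stateWins_of_row`, every row a `decide` at the gate):

* `stateWins_rename_iff` — A's attractor of the PLAIN global game (`StateWins`) is `S₄`-invariant (the in-scope
  analogue is `ScopeSymmetry.inScopeStateWins_rename_iff`);
* **`pureLeafGlobalWin_box4`** — for every exponent vector `a` with entries `≤ 4`, an odd entry and `|a| ≥ 2`, listed
  in decreasing order, EXCEPT the four heaviest (3,3,3,3), (4,3,3,3), (4,4,3,3), (4,4,4,3) (50 vectors; the four need
  win-DAG nodes whose `decide` exceeds the gate's elaboration budget and stay CANDIDATE by the one-lane census), and EVERY booking `(r, exc)`: `StateWins 2 ⟨x^a, r, exc⟩` over `𝔽₂` — player A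
  (cardinality-first centres) beats every sequence of `𝔽₂`-rational replies in the tree's `Edge`, along-centre moves
  included; `pureLeafGlobalWin_box4_rename` — the same for every renaming of the variables (all orderings);
* `PureLeafGlobalWinQuestion` — the typed QUESTION «the same for every exponent vector with an odd entry» (OURS; a
  paper proof over `𝔽₂` with the invariant class «products of `x^a(1+x)^e` + `Θ·L`-states» and the measure `deg F`
  is in the seat's HOME `res-dim4-p-10/D3b-PAPER.md`; NOT a kernel theorem; conjectured for every field of
  characteristic 2).

Riders: `𝔽₂`-rational replies only; MODE 1h; the leaf property itself is not absorbing along the centre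
(`…LeafStepSpecimens` X1) — the point is that A still wins.  Nothing here proves resolution of singularities in
dimension ≥ 4 / characteristic `p`; counted 0; AI work, weaker than expert review. bears_on: LADDER-RESOLUTION:D157-DOOR2
(res-dim4-pi · WORD #60 · LEAF-GLOBAL row). Supports stmt-ResolutionOfSingularities-16155 (helper).
-/

set_option linter.dupNamespace false

noncomputable section

open MvPolynomial

namespace Summit.ResolutionOfSingularities.ResolutionOfSingularities.Theorems.PIDim4

namespace PureLeafGlobalWin

open Literature.AlgebraicGeometry.Resolution
open StepKit WinCertF InScopeWinCert

/-! ## 1. `S₄`-symmetry of the plain-game attractor -/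

section Symmetry

variable {K : Type} [Field K] [DecidableEq K] (e : Equiv.Perm (Fin 4))

/-- Escapable states rename to escapable states (plain global game). [folklore] -/
theorem stateWins_rename (q : ℕ) {s : State K} (h : StateWins q s) : StateWins q (s.rename e) := by
  unfold StateWins at h ⊢
  induction h with
  | @terminal s hs =>
    refine Game.Wins.terminal fun S hS => hs (S.map e.symm.toEmbedding) ?_
    rw [← Equivariance.isPermissibleCentre_rename_iff e, Equivariance.map_symm_map]
    exact hS
  | @move s S hS _ ih =>
    refine Game.Wins.move (m := S.map e.toEmbedding)
      ((Equivariance.isPermissibleCentre_rename_iff e q S s.F).mpr hS) fun t' ht' => ?_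
    have hback := Equivariance.edge_rename e.symm ht'
    rw [Equivariance.rename_rename_symm] at hback
    have hS' : (S.map e.toEmbedding).map e.symm.toEmbedding = S := by
      have h1 := Equivariance.map_symm_map e.symm S
      rwa [Equiv.symm_symm] at h1
    rw [hS'] at hback
    have hw := ih (t'.rename e.symm) hback
    have ht : (t'.rename e.symm).rename e = t' := by
      have h2 := Equivariance.rename_rename_symm e.symm t'
      rwa [Equiv.symm_symm] at h2
    rwa [ht] at hw

/-- **The plain-game attractor is `S₄`-invariant.** [folklore] -/
theorem stateWins_rename_iff (q : ℕ) (s : State K) : StateWins q (s.rename e) ↔ StateWins q s := by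
  refine ⟨fun h => ?_, stateWins_rename e q⟩
  have h' := stateWins_rename e.symm q h
  rwa [Equivariance.rename_rename_symm] at h'

end Symmetry

/-! ## 2. The kernel box: exponents ≤ 4 over `𝔽₂` -/

/-- **PURE LEAVES WITH EXPONENTS ≤ 4 WIN THE GLOBAL GAME OVER `𝔽₂`.** For each of the 50 decreasing exponent
vectors `a` with entries `≤ 4`, an odd entry and `|a| ≥ 2` (all but the four heaviest, see the file header), and every booking: `StateWins 2 ⟨x^a, r, exc⟩`
(the roots of `…PureLeafGlobalWin18`). [OURS · counted 0 · ‖ K] -/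
theorem pureLeafGlobalWin_box4 :
    ∀ a ∈ ([![1, 1, 0, 0], ![1, 1, 1, 0], ![1, 1, 1, 1], ![2, 1, 0, 0], ![2, 1, 1, 0], ![2, 1, 1, 1], ![2, 2, 1, 0], ![2, 2, 1, 1], ![2, 2, 2, 1], ![3, 0, 0, 0], ![3, 1, 0, 0], ![3, 1, 1, 0], ![3, 1, 1, 1], ![3, 2, 0, 0], ![3, 2, 1, 0], ![3, 2, 1, 1], ![3, 2, 2, 0], ![3, 2, 2, 1], ![3, 2, 2, 2], ![3, 3, 0, 0], ![3, 3, 1, 0], ![3, 3, 1, 1], ![3, 3, 2, 0], ![3, 3, 2, 1], ![3, 3, 2, 2], ![3, 3, 3, 0], ![3, 3, 3, 1], ![3, 3, 3, 2], ![4, 1, 0, 0], ![4, 1, 1, 0], ![4, 1, 1, 1], ![4, 2, 1, 0], ![4, 2, 1, 1], ![4, 2, 2, 1], ![4, 3, 0, 0], ![4, 3, 1, 0], ![4, 3, 1, 1], ![4, 3, 2, 0], ![4, 3, 2, 1], ![4, 3, 2, 2], ![4, 3, 3, 0], ![4, 3, 3, 1], ![4, 3, 3, 2], ![4, 4, 1,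 0], ![4, 4, 1, 1], ![4, 4, 2, 1], ![4, 4, 3, 0], ![4, 4, 3, 1], ![4, 4, 3, 2], ![4, 4, 4, 1]] : List (Fin 4 → ℕ)),
      ∀ (r : Fin 4 →₀ ℕ) (exc : Finset (Fin 4)),
        StateWins 2 (⟨evalT ([(a, 1)] : Terms 4 (ZMod 2)), r, exc⟩ : State (ZMod 2)) :=
  List.forall_mem_cons.mpr ⟨fun r exc => (root_1_1_0_0 r exc).1, List.forall_mem_cons.mpr ⟨fun r exc => (root_1_1_1_0 r exc).1, List.forall_mem_cons.mpr ⟨fun r exc => (root_1_1_1_1 r exc).1, List.forall_mem_cons.mpr ⟨fun r exc => (root_2_1_0_0 r exc).1, List.forall_mem_cons.mpr ⟨fun r exc => (root_2_1_1_0 r exc).1, List.forall_mem_cons.mpr ⟨fun r exc => (root_2_1_1_1 r exc).1, List.forall_mem_cons.mpr ⟨fun r exc => (root_2_2_1_0 r exc).1, List.forall_mem_cons.mpr ⟨fun r exc => (root_2_2_1_1 r exc).1, List.forall_mem_cons.mpr ⟨fun r exc => (root_2_2_2_1 r exc).1, List.forall_mem_cons.mpr ⟨fun r exc => (root_3_0_0_0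 r exc).1, List.forall_mem_cons.mpr ⟨fun r exc => (root_3_1_0_0 r exc).1, List.forall_mem_cons.mpr ⟨fun r exc => (root_3_1_1_0 r exc).1, List.forall_mem_cons.mpr ⟨fun r exc => (root_3_1_1_1 r exc).1, List.forall_mem_cons.mpr ⟨fun r exc => (root_3_2_0_0 r exc).1, List.forall_mem_cons.mpr ⟨fun r exc => (root_3_2_1_0 r exc).1, List.forall_mem_cons.mpr ⟨fun r exc => (root_3_2_1_1 r exc).1, List.forall_mem_cons.mpr ⟨fun r exc => (root_3_2_2_0 r exc).1, List.forall_mem_cons.mpr ⟨fun r exc => (root_3_2_2_1 r exc).1, List.forall_mem_cons.mpr ⟨fun r exc => (root_3_2_2_2 r exc).1, List.forall_mem_cons.mpr ⟨fun r exc => (root_3_3_0_0 r exc).1, List.forall_mem_cons.mpr ⟨fun r exc => (root_3_3_1_0 r exc).1, List.forall_mem_cons.mpr ⟨fun r exc => (root_3_3_1_1 r exc).1, List.forall_mem_cons.mpr ⟨fun r exc => (root_3_3_2_0 r exc).1, List.forall_mem_cons.mpr ⟨fun r exc => (root_3_3_2_1 r exc).1, List.forall_mem_cons.mpr ⟨fun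 r exc => (root_3_3_2_2 r exc).1, List.forall_mem_cons.mpr ⟨fun r exc => (root_3_3_3_0 r exc).1, List.forall_mem_cons.mpr ⟨fun r exc => (root_3_3_3_1 r exc).1, List.forall_mem_cons.mpr ⟨fun r exc => (root_3_3_3_2 r exc).1, List.forall_mem_cons.mpr ⟨fun r exc => (root_4_1_0_0 r exc).1, List.forall_mem_cons.mpr ⟨fun r exc => (root_4_1_1_0 r exc).1, List.forall_mem_cons.mpr ⟨fun r exc => (root_4_1_1_1 r exc).1, List.forall_mem_cons.mpr ⟨fun r exc => (root_4_2_1_0 r exc).1, List.forall_mem_cons.mpr ⟨fun r exc => (root_4_2_1_1 r exc).1, List.forall_mem_cons.mpr ⟨fun r exc => (root_4_2_2_1 r exc).1, List.forall_mem_cons.mpr ⟨fun r exc => (root_4_3_0_0 r exc).1, List.forall_mem_cons.mpr ⟨fun r exc => (root_4_3_1_0 r exc).1, List.forall_mem_cons.mpr ⟨fun r exc => (root_4_3_1_1 r exc).1, List.forall_mem_cons.mpr ⟨fun r exc => (root_4_3_2_0 r exc).1, List.forall_mem_cons.mpr ⟨fun r exc => (root_4_3_2_1 r exc).1, List.forall_mem_cons.mpr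 ⟨fun r exc => (root_4_3_2_2 r exc).1, List.forall_mem_cons.mpr ⟨fun r exc => (root_4_3_3_0 r exc).1, List.forall_mem_cons.mpr ⟨fun r exc => (root_4_3_3_1 r exc).1, List.forall_mem_cons.mpr ⟨fun r exc => (root_4_3_3_2 r exc).1, List.forall_mem_cons.mpr ⟨fun r exc => (root_4_4_1_0 r exc).1, List.forall_mem_cons.mpr ⟨fun r exc => (root_4_4_1_1 r exc).1, List.forall_mem_cons.mpr ⟨fun r exc => (root_4_4_2_1 r exc).1, List.forall_mem_cons.mpr ⟨fun r exc => (root_4_4_3_0 r exc).1, List.forall_mem_cons.mpr ⟨fun r exc => (root_4_4_3_1 r exc).1, List.forall_mem_cons.mpr ⟨fun r exc => (root_4_4_3_2 r exc).1, List.forall_mem_cons.mpr ⟨fun r exc => (root_4_4_4_1 r exc).1, (fun _ h => absurd h List.not_mem_nil)⟩⟩⟩⟩⟩⟩⟩⟩⟩⟩⟩⟩⟩⟩⟩⟩⟩⟩⟩⟩⟩⟩⟩⟩⟩⟩⟩⟩⟩⟩⟩⟩⟩⟩⟩⟩⟩⟩⟩⟩⟩⟩⟩⟩⟩⟩⟩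⟩⟩⟩

/-- … and for every RENAMING of the variables (so for every exponent vector with entries `≤ 4` in any order).
[OURS · counted 0 · ‖ K] -/
theorem pureLeafGlobalWin_box4_rename (e : Equiv.Perm (Fin 4)) :
    ∀ a ∈ ([![1, 1, 0, 0], ![1, 1, 1, 0], ![1, 1, 1, 1], ![2, 1, 0, 0], ![2, 1, 1, 0], ![2, 1, 1, 1], ![2, 2, 1, 0], ![2, 2, 1, 1], ![2, 2, 2, 1], ![3, 0, 0, 0], ![3, 1, 0, 0], ![3, 1, 1, 0], ![3, 1, 1, 1], ![3, 2, 0, 0], ![3, 2, 1, 0], ![3, 2, 1, 1], ![3, 2, 2, 0], ![3, 2, 2, 1], ![3, 2, 2, 2], ![3, 3, 0, 0], ![3, 3, 1, 0], ![3, 3, 1, 1], ![3, 3, 2, 0], ![3, 3, 2, 1], ![3, 3, 2, 2], ![3, 3, 3, 0], ![3, 3, 3, 1], ![3, 3, 3, 2], ![4, 1, 0, 0], ![4, 1, 1, 0], ![4, 1, 1, 1], ![4, 2, 1, 0], ![4, 2, 1, 1], ![4, 2, 2, 1], ![4, 3, 0, 0], ![4, 3, 1, 0], ![4, 3, 1,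 1], ![4, 3, 2, 0], ![4, 3, 2, 1], ![4, 3, 2, 2], ![4, 3, 3, 0], ![4, 3, 3, 1], ![4, 3, 3, 2], ![4, 4, 1, 0], ![4, 4, 1, 1], ![4, 4, 2, 1], ![4, 4, 3, 0], ![4, 4, 3, 1], ![4, 4, 3, 2], ![4, 4, 4, 1]] : List (Fin 4 → ℕ)),
      ∀ (r : Fin 4 →₀ ℕ) (exc : Finset (Fin 4)),
        StateWins 2 (State.rename e (⟨evalT ([(a, 1)] : Terms 4 (ZMod 2)), r, exc⟩ : State (ZMod 2))) :=
  fun a ha r exc => stateWins_rename e 2 (pureLeafGlobalWin_box4 a ha r exc)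

/-! ## 3. The typed question -/

/-- **QUESTION (OURS): every pure monomial leaf wins the plain GLOBAL game over `𝔽₂`.** For every exponent vector
`a` with an odd entry and every booking, `StateWins 2 ⟨x^a, r, exc⟩` over `𝔽₂` (`|a| ≤ 1` is a win with no move).  Kernel
evidence: `pureLeafGlobalWin_box4`; paper proof (MODE 1h, invariant class «∏ x_i^{aᵢ}(1+x_i)^{eᵢ} with parity
invariants ∪ Θ·L-states», measure `deg F`): HOME `res-dim4-p-10/D3b-PAPER.md`.  A typed question of this programme,
not a statement of the literature; nothing about resolution of singularities. [OURS · CANDIDATE FRAME] -/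
def PureLeafGlobalWinQuestion : Prop :=
  ∀ (a : Fin 4 →₀ ℕ), (∃ i, ¬ 2 ∣ a i) →
    ∀ (r : Fin 4 →₀ ℕ) (exc : Finset (Fin 4)),
      StateWins 2 (⟨monomial a (1 : ZMod 2), r, exc⟩ : State (ZMod 2))

end PureLeafGlobalWin

end Summit.ResolutionOfSingularities.ResolutionOfSingularities.Theorems.PIDim4

end
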